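import Summits.CriticalPhenomena.Ising3DConformalLimit.Theorems.PrecisionLaplacianDirectCorrelationStableTailPickInversion

/-!
# Axis line holomorphy of the Green symbol function, auxiliary file 2:
# the Poisson representation of the Green symbol function on every axis line off the lattice,
# and the uniform symbol gap at a positive distance from the reciprocal lattice

Helper file for the sub-stub `stub_slabModeExpDecay_auxAxisLineHol` (brick of `stub_slabModeExpDecay`)
of line `self-energy-pick-inversion`, crux `PrecisionLaplacian.DirectCorrelationStableTail`
(stmt-CriticalPhenomena-4799). Pure theorem file, in the abstract setting of
`slabMoments_of_openCube` (file `…PickInversionAux17`): `q` an even sub-stochastic step law on `ℤ³`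
with Green function `G = ∑ⱼ q^{∗j}` positive at the unit vectors and Hausdorff slab quadratic forms,
symbol `φ(ξ) = ∑ₓ q(x) cos(ξ·x)`.

* `exists_symbol_gap_of_margin` : for every `m > 0` there is `η > 0` with `1 - φ(ξ) ≥ η` whenever
  `ξ` is at sup-distance `≥ m` from `(2πℤ)³` (periodicity, compactness, `φ < 1` off the lattice);
* `slabMoments_of_not_mem_lattice` : the cosine moments of `θ ↦ 1/(1 - φ(ins_i(θ, k)))` form a
  Hausdorff moment sequence for EVERY transverse momentum `k ∉ (2πℤ)²` (the good momenta of
  `slabMoments_of_openCube`, then periodicity in `k`, continuity of the slab transforms off the bad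
  set and Hausdorff weak compactness `exists_hausdorffMeasure_of_momentLimit`);
* `slab_two_pi_mul_inv_eq_integral_poisson` (registered sub-goal `stub_slabModeExpDecay_auxAxisLineHol3`):
  consequently `2π/(1 - φ(ins_i(θ, k))) = ∫ (1 - t²)/(1 - 2t cos θ + t²) dμ_k(t)` for `cos θ ≠ 1`, with a
  finite positive measure `μ_k` on `[0, 1]` of mass `∫_{-π}^{π} dθ/(1 - φ(ins_i(θ, k)))`
  (`two_pi_mul_eq_integral_poisson`, file `…PickInversionAux2`).

References: Aizenman–Duminil-Copin (2021), Prop. 8.6 (spectral representation); Katznelson,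
*An introduction to harmonic analysis*, Ch. I (Poisson kernel).
-/

noncomputable section

namespace Summit.CriticalPhenomena.Ising3DConformalLimit.Cruxes.DirectCorrelationStableTail.SelfEnergyPickInversion

open MeasureTheory Filter Topology Finset Real Literature.Probability.LatticeModels
open scoped BigOperators
open Summit.CriticalPhenomena.Ising3DConformalLimit.Theorems.EtaBoundsTransfer (continuous_fourier_q)

/-! ### Periodicity of the symbol and reduction to the closed cube -/

/-- Periodicity of cosine transforms on `ℤ^d` under `ξ ↦ ξ + 2πL`. [folklore] -/
theorem tsum_mul_cos_phase_add_lattice {d : ℕ} (f : Site d → ℝ) (ξ : Fin d → ℝ) (L : Fin d → ℤ) :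
    ∑' x : Site d, f x * Real.cos (phase d (fun j => ξ j + 2 * π * (L j : ℝ)) x) =
      ∑' x : Site d, f x * Real.cos (phase d ξ x) := by
  refine tsum_congr fun x => ?_
  congr 1
  have : phase d (fun j => ξ j + 2 * π * (L j : ℝ)) x = phase d ξ x + ((∑ j, L j * x j : ℤ) : ℝ) * (2 * π) := by
    simp only [phase, add_mul, Finset.sum_add_distrib, Int.cast_sum, Int.cast_mul, Finset.sum_mul]
    congr 1
    exact Finset.sum_congr rfl fun j _ => by ring
  rw [this, Real.cos_add_int_mul_two_pi]

/-- Reduction of a momentum to the closed cube `[-π, π]^d` modulo `(2πℤ)^d`. [folklore] -/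
theorem exists_reduce_cube {d : ℕ} (ξ : Fin d → ℝ) : ∃ (ξ' : Fin d → ℝ) (L : Fin d → ℤ),
    (∀ j, ξ' j ∈ Set.Icc (-π) π) ∧ ∀ j, ξ j = ξ' j + 2 * π * (L j : ℝ) := by
  refine ⟨fun j => toIocMod Real.two_pi_pos (-π) (ξ j), fun j => toIocDiv Real.two_pi_pos (-π) (ξ j),
    fun j => ?_, fun j => ?_⟩
  · have h := toIocMod_mem_Ioc Real.two_pi_pos (-π) (ξ j)
    exact ⟨h.1.le, by linarith [h.2]⟩
  · have h := toIocMod_add_toIocDiv_zsmul Real.two_pi_pos (-π) (ξ j)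
    rw [zsmul_eq_mul] at h
    linarith

/-- A point at positive sup-distance from `(2πℤ)^d` has a coordinate off `2πℤ`. [folklore] -/
theorem exists_coord_not_mem_of_margin {d : ℕ} {m : ℝ} (hm : 0 < m) {ξ : Fin d → ℝ}
    (hξ : ∀ L : Fin d → ℤ, m ≤ ‖(fun j => ξ j - 2 * π * (L j : ℝ))‖) :
    ∃ j : Fin d, ∀ z : ℤ, ξ j ≠ z * (2 * π) := by
  by_contra h
  push Not at h
  choose L hL using h
  have h0 : (fun j => ξ j - 2 * π * (L j : ℝ)) = 0 := by
    funext j; rw [hL j]; simp only [Pi.zero_apply]; ring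
  have := hξ L
  rw [h0, norm_zero] at this
  exact absurd this (not_le.2 hm)

section Slab

variable {q : Site 3 → ℝ} {P : ℕ → Site 3 → ℝ} {G : Site 3 → ℝ}

/-! ### The uniform symbol gap at a positive distance from the reciprocal lattice -/

/-- **Uniform symbol gap.** For the Green function of a sub-stochastic step law `q`, positive at the
unit vectors, and every `m > 0` there is `η > 0` with `η ≤ 1 - φ(ξ)` for all `ξ` at sup-distance
`≥ m` from `(2πℤ)³`. [folklore] -/
theorem exists_symbol_gap_of_margin (hq0 : ∀ y, 0 ≤ q y) (hqs : Summable q) (hq1 : ∑' y, q y ≤ 1)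
    (hP0 : ∀ z, P 0 z = if z = 0 then 1 else 0) (hPs : ∀ j z, P (j + 1) z = ∑' y, q y * P j (z - y))
    (hGreen : ∀ z, HasSum (fun j => P j z) (G z)) (hGpos : ∀ m : Fin 3, 0 < G (Pi.single m 1))
    {m : ℝ} (hm : 0 < m) :
    ∃ η : ℝ, 0 < η ∧ ∀ ξ : Fin 3 → ℝ, (∀ L : Fin 3 → ℤ, m ≤ ‖(fun j => ξ j - 2 * π * (L j : ℝ))‖) →
      η ≤ 1 - ∑' x : Site 3, q x * Real.cos (phase 3 ξ x) := by
  set φ : (Fin 3 → ℝ) → ℝ := fun ξ => ∑' x : Site 3, q x * Real.cos (phase 3 ξ x) with hφ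
  have hφcont : Continuous φ := continuous_fourier_q hqs
  -- the symbol is `< 1` at points with a margin
  have hlt : ∀ ξ : Fin 3 → ℝ, (∀ L : Fin 3 → ℤ, m ≤ ‖(fun j => ξ j - 2 * π * (L j : ℝ))‖) → φ ξ < 1 :=
    fun ξ hξ => symbol_lt_one_of_not_mem_lattice hq0 hqs hq1 hP0 hPs hGreen hGpos
      (exists_coord_not_mem_of_margin hm hξ)
  -- the compact set of reduced momenta with a margin
  set K : Set (Fin 3 → ℝ) := Set.pi Set.univ (fun _ : Fin 3 => Set.Icc (-π) π) ∩
    {ξ | ∀ L : Fin 3 → ℤ, m ≤ ‖(fun j => ξ j - 2 * π * (L j : ℝ))‖} with hK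
  have hclosed : IsClosed {ξ : Fin 3 → ℝ | ∀ L : Fin 3 → ℤ, m ≤ ‖(fun j => ξ j - 2 * π * (L j : ℝ))‖} := by
    simp only [Set.setOf_forall]
    refine isClosed_iInter fun L => isClosed_le continuous_const ?_
    exact continuous_norm.comp (continuous_pi fun j => (continuous_apply j).sub continuous_const)
  have hKc : IsCompact K := (isCompact_univ_pi fun _ => isCompact_Icc).inter_right hclosed
  -- reduction of an arbitrary momentum with a margin to `K`
  have hred : ∀ ξ : Fin 3 → ℝ, (∀ L : Fin 3 → ℤ, m ≤ ‖(fun j => ξ j - 2 * π * (L j : ℝ))‖) →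
      ∃ ξ' ∈ K, φ ξ = φ ξ' := by
    intro ξ hξ
    obtain ⟨ξ', L₀, hcube, hdec⟩ := exists_reduce_cube ξ
    have hfun : ξ = fun j => ξ' j + 2 * π * (L₀ j : ℝ) := funext hdec
    refine ⟨ξ', ⟨fun j _ => hcube j, fun L => ?_⟩, by rw [hfun]; exact tsum_mul_cos_phase_add_lattice q ξ' L₀⟩
    have h := hξ (L + L₀)
    have heq : (fun j => ξ j - 2 * π * ((L + L₀) j : ℝ)) = fun j => ξ' j - 2 * π * (L j : ℝ) := by
      funext j; rw [hdec j, Pi.add_apply, Int.cast_add]; ring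
    rwa [heq] at h
  rcases K.eq_empty_or_nonempty with hK0 | hKne
  · refine ⟨1, one_pos, fun ξ hξ => ?_⟩
    obtain ⟨ξ', hξ'K, -⟩ := hred ξ hξ
    rw [hK0] at hξ'K
    exact absurd hξ'K (Set.notMem_empty _)
  · obtain ⟨ξ₀, hξ₀K, hmin⟩ := hKc.exists_isMinOn hKne (f := fun ξ => 1 - φ ξ) (by fun_prop)
    refine ⟨1 - φ ξ₀, by linarith [hlt ξ₀ hξ₀K.2], fun ξ hξ => ?_⟩
    obtain ⟨ξ', hξ'K, hφeq⟩ := hred ξ hξ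
    have h := (isMinOn_iff.mp hmin) ξ' hξ'K
    simp only [hφ] at hφeq h ⊢
    rw [hφeq]
    exact h

/-! ### Hausdorff cosine moments at every transverse momentum off the lattice -/

/-- Periodicity of the symbol on a slab in the transverse momentum. [folklore] -/
theorem symbol_slab_add_lattice (q : Site 3 → ℝ) (i : Fin 3) (θ : ℝ) (k : Fin 2 → ℝ) (m : Fin 2 → ℤ) :
    ∑' x : Site 3, q x * Real.cos (phase 3 (Fin.insertNth i θ (fun j => k j + (m j : ℝ) * (2 * π)) : Fin 3 → ℝ) x) =
      ∑' x : Site 3, q x * Real.cos (phase 3 (Fin.insertNth i θ k : Fin 3 → ℝ) x) := by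
  refine tsum_congr fun x => ?_
  congr 1
  rw [phase_insertNth, phase_insertNth]
  have : phase 2 (fun j => k j + (m j : ℝ) * (2 * π)) (fun j => x (i.succAbove j)) =
      phase 2 k (fun j => x (i.succAbove j)) + ((∑ j, m j * x (i.succAbove j) : ℤ) : ℝ) * (2 * π) := by
    simp only [phase, add_mul, Finset.sum_add_distrib, Int.cast_sum, Int.cast_mul, Finset.sum_mul]
    congr 1
    exact Finset.sum_congr rfl fun j _ => by ring
  rw [this, ← add_assoc, Real.cos_add_int_mul_two_pi]

/-- **Hausdorff cosine moments at every transverse momentum off the lattice.** In the setting of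
`slabMoments_of_openCube`, for every `k ∈ ℝ²` with a coordinate off `2πℤ`, the symbol is `< 1` on the
slab circle `{ins_i(θ, k)}` and `(∫_{-π}^{π} cos(nθ)/(1 - φ(ins_i(θ, k))) dθ)_n` is the moment sequence
of a finite positive measure on `[0, 1]`. [folklore] -/
theorem slabMoments_of_not_mem_lattice (hq0 : ∀ y, 0 ≤ q y) (hqs : Summable q) (hq1 : ∑' y, q y ≤ 1)
    (hqev : ∀ y, q (-y) = q y)
    (hP0 : ∀ z, P 0 z = if z = 0 then 1 else 0) (hPs : ∀ j z, P (j + 1) z = ∑' y, q y * P j (z - y))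
    (hGreen : ∀ z, HasSum (fun j => P j z) (G z)) (hGpos : ∀ m : Fin 3, 0 < G (Pi.single m 1))
    (i : Fin 3)
    (hHS : ∀ (s : Finset (Fin 2 → ℤ)) (v : (Fin 2 → ℤ) → ℝ), ∃ μ : Measure ℝ, IsFiniteMeasure μ ∧
      μ (Set.Icc (0 : ℝ) 1)ᶜ = 0 ∧ ∀ n : ℕ,
        ∑ x ∈ s, ∑ y ∈ s, v x * v y * G (Fin.insertNth i (n : ℤ) (x - y) : Site 3) = ∫ t, t ^ n ∂μ)
    {k : Fin 2 → ℝ} (hk : ∃ j, ∀ z : ℤ, k j ≠ z * (2 * π)) :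
    (∀ θ : ℝ, ∑' x : Site 3, q x * Real.cos (phase 3 (Fin.insertNth i θ k : Fin 3 → ℝ) x) < 1) ∧
    ∃ μ : Measure ℝ, IsFiniteMeasure μ ∧ μ (Set.Icc (0 : ℝ) 1)ᶜ = 0 ∧ ∀ n : ℕ,
      ∫ θ in (-π)..π, Real.cos (n * θ) /
        (1 - ∑' x : Site 3, q x * Real.cos (phase 3 (Fin.insertNth i θ k : Fin 3 → ℝ) x)) = ∫ t, t ^ n ∂μ := by
  have hπ := Real.pi_pos
  set φ : (Fin 3 → ℝ) → ℝ := fun ξ => ∑' x : Site 3, q x * Real.cos (phase 3 ξ x) with hφ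
  have hφcont : Continuous φ := continuous_fourier_q hqs
  set h : ℕ → (Fin 2 → ℝ) → ℝ := fun n k => ∫ θ in (-π)..π, Real.cos (n * θ) /
    (1 - φ (Fin.insertNth i θ k)) with hh
  -- the symbol is `< 1` on every slab circle off the lattice
  have hlt : ∀ k' : Fin 2 → ℝ, (∃ j, ∀ z : ℤ, k' j ≠ z * (2 * π)) → ∀ θ, φ (Fin.insertNth i θ k') < 1 := by
    rintro k' ⟨j, hj⟩ θ
    refine symbol_lt_one_of_not_mem_lattice hq0 hqs hq1 hP0 hPs hGreen hGpos ⟨i.succAbove j, fun z hz => ?_⟩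
    rw [Fin.insertNth_apply_succAbove] at hz
    exact hj z hz
  -- reduction modulo `2πℤ²` and approximation by good momenta
  obtain ⟨k', m, km, hkk', hlim, hkm⟩ := exists_reduce_approx k
  have hkfun : k = fun j => k' j + (m j : ℝ) * (2 * π) := funext hkk'
  have hk' : ∃ j, ∀ z : ℤ, k' j ≠ z * (2 * π) := by
    obtain ⟨j, hj⟩ := hk
    refine ⟨j, fun z hz => hj (z + m j) ?_⟩
    rw [hkk' j, hz, Int.cast_add]; ring
  have hper : ∀ n, h n k = h n k' := by
    intro n
    simp only [hh, hφ]
    refine intervalIntegral.integral_congr fun θ _ => ?_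
    rw [hkfun, symbol_slab_add_lattice q i θ k' m]
  -- continuity of the slab transforms at `k'`
  have hcontAt : ∀ n, ContinuousAt (h n) k' := by
    intro n
    obtain ⟨j₀, hj₀⟩ := hk'
    have hopen : IsOpen {k'' : Fin 2 → ℝ | Real.cos (k'' j₀) < 1} :=
      isOpen_lt (Real.continuous_cos.comp (continuous_apply j₀)) continuous_const
    have hmem : k' ∈ {k'' : Fin 2 → ℝ | Real.cos (k'' j₀) < 1} := by
      refine lt_of_le_of_ne (Real.cos_le_one _) fun h1 => ?_
      obtain ⟨z, hz⟩ := (Real.cos_eq_one_iff _).1 h1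
      exact hj₀ z hz.symm
    obtain ⟨ε, hε, hball⟩ := Metric.isOpen_iff.1 hopen k' hmem
    have hpos : ∀ k'' ∈ Metric.closedBall k' (ε / 2), ∀ θ ∈ Set.Icc (-π) π,
        0 < 1 - φ (Fin.insertNth i θ k'') := by
      intro k'' hk'' θ _
      have hk''S : Real.cos (k'' j₀) < 1 := hball (Metric.closedBall_subset_ball (by linarith) hk'')
      have hk''good : ∃ j, ∀ z : ℤ, k'' j ≠ z * (2 * π) := by
        refine ⟨j₀, fun z hz => ?_⟩
        have : Real.cos (k'' j₀) = 1 := (Real.cos_eq_one_iff _).2 ⟨z, hz.symm⟩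
        linarith
      linarith [hlt k'' hk''good θ]
    have hc := continuousAt_slab_transform i (Φ := fun ξ => 1 - φ ξ) (by fun_prop) (half_pos hε) hpos n
    exact hc
  -- moment measures at the good momenta
  have hgood : ∀ N, ∃ μ : Measure ℝ, IsFiniteMeasure μ ∧ μ (Set.Icc (0 : ℝ) 1)ᶜ = 0 ∧ ∀ n : ℕ,
      h n (km N) = ∫ t, t ^ n ∂μ := fun N =>
    (slabMoments_of_openCube hq0 hqs hq1 hqev hP0 hPs hGreen hGpos i hHS (hkm N).1 (hkm N).2).2
  choose μN hfin h0 hmom using hgood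
  have hlimN : ∀ n, Tendsto (fun N => ∫ t, t ^ n ∂(μN N)) atTop (𝓝 (h n k')) := by
    intro n
    have h1 : Tendsto (fun N => h n (km N)) atTop (𝓝 (h n k')) := (hcontAt n).tendsto.comp hlim
    exact h1.congr fun N => hmom N n
  obtain ⟨M, hM⟩ := (hlimN 0).bddAbove_range
  have hle : ∀ N n, n ≤ N → ∫ t, t ^ n ∂(μN N) ≤ M := by
    intro N n _
    haveI := hfin N
    exact ((integrable_pow_of_Icc (h0 N) n).2).trans (hM ⟨N, rfl⟩)
  obtain ⟨μ, hμfin, hμ0, hμmom⟩ := exists_hausdorffMeasure_of_momentLimit (fun n => h n k') μN hfin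
    (fun N => measure_mono_null (fun t ht => by
      simp only [Set.mem_Iio] at ht; exact fun h => absurd h.1 (not_le.2 ht)) (h0 N))
    (fun N n => by haveI := hfin N; exact (integrable_pow_of_Icc (h0 N) n).1) hle hlimN
  refine ⟨hlt k hk, μ, hμfin, hμ0, fun n => ?_⟩
  have h1 : h n k = ∫ t, t ^ n ∂μ := by rw [hper n]; exact hμmom n
  simpa only [hh, hφ] using h1

/-! ### The Poisson representation on an axis line -/

/-- **Poisson representation of the Green symbol function on an axis line off the lattice.** In the
setting of `slabMoments_of_openCube`, with `q` symmetric under the reflection of the `i`-th coordinate,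
for every `k ∈ ℝ²` with a coordinate off `2πℤ` there is a finite positive measure `μ` on `[0, 1]`, of
mass `∫_{-π}^{π} dθ/(1 - φ(ins_i(θ, k)))`, with `2π/(1 - φ(ins_i(θ, k))) = ∫ (1 - t²)/(1 - 2t cos θ + t²) dμ(t)`
whenever `cos θ ≠ 1`; moreover `φ < 1` on the slab circle and `θ ↦ 1/(1 - φ(ins_i(θ, k)))` is continuous.
[folklore] -/
theorem slab_two_pi_mul_inv_eq_integral_poisson (hq0 : ∀ y, 0 ≤ q y) (hqs : Summable q)
    (hq1 : ∑' y, q y ≤ 1) (hqev : ∀ y, q (-y) = q y)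
    (hP0 : ∀ z, P 0 z = if z = 0 then 1 else 0) (hPs : ∀ j z, P (j + 1) z = ∑' y, q y * P j (z - y))
    (hGreen : ∀ z, HasSum (fun j => P j z) (G z)) (hGpos : ∀ m : Fin 3, 0 < G (Pi.single m 1))
    (i : Fin 3) (hqrefl : ∀ y : Site 3, q (Function.update y i (-y i)) = q y)
    (hHS : ∀ (s : Finset (Fin 2 → ℤ)) (v : (Fin 2 → ℤ) → ℝ), ∃ μ : Measure ℝ, IsFiniteMeasure μ ∧
      μ (Set.Icc (0 : ℝ) 1)ᶜ = 0 ∧ ∀ n : ℕ,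
        ∑ x ∈ s, ∑ y ∈ s, v x * v y * G (Fin.insertNth i (n : ℤ) (x - y) : Site 3) = ∫ t, t ^ n ∂μ)
    {k : Fin 2 → ℝ} (hk : ∃ j, ∀ z : ℤ, k j ≠ z * (2 * π)) :
    (∀ θ : ℝ, ∑' x : Site 3, q x * Real.cos (phase 3 (Fin.insertNth i θ k : Fin 3 → ℝ) x) < 1) ∧
    (Continuous fun θ : ℝ =>
      (1 - ∑' x : Site 3, q x * Real.cos (phase 3 (Fin.insertNth i θ k : Fin 3 → ℝ) x))⁻¹) ∧
    ∃ μ : Measure ℝ, IsFiniteMeasure μ ∧ μ (Set.Icc (0 : ℝ) 1)ᶜ = 0 ∧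
      μ.real Set.univ = ∫ θ in (-π)..π,
        (1 - ∑' x : Site 3, q x * Real.cos (phase 3 (Fin.insertNth i θ k : Fin 3 → ℝ) x))⁻¹ ∧
      ∀ θ : ℝ, Real.cos θ ≠ 1 →
        2 * π * (1 - ∑' x : Site 3, q x * Real.cos (phase 3 (Fin.insertNth i θ k : Fin 3 → ℝ) x))⁻¹ =
          ∫ t, (1 - t ^ 2) / (1 - 2 * t * Real.cos θ + t ^ 2) ∂μ := by
  have hπ := Real.pi_pos
  obtain ⟨hlt, μ, hμfin, hμ0, hmom⟩ :=
    slabMoments_of_not_mem_lattice hq0 hqs hq1 hqev hP0 hPs hGreen hGpos i hHS hk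
  haveI := hμfin
  -- adapted from `hausdorff_slabModes_of_good` (file `…PickInversion`)
  set φθ : ℝ → ℝ := fun θ => ∑' x : Site 3, q x * Real.cos (phase 3 (Fin.insertNth i θ k : Fin 3 → ℝ) x)
    with hφθ
  have hφcont : Continuous φθ := (continuous_fourier_q hqs).comp (continuous_insertNth_left i k)
  set g : ℝ → ℝ := fun θ => (1 - φθ θ)⁻¹ with hg
  have hden : ∀ θ, 0 < 1 - φθ θ := fun θ => by have := hlt θ; simp only [hφθ]; linarith
  have hgcont : Continuous g := Continuous.inv₀ (by fun_prop) fun θ => (hden θ).ne'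
  have hφper : Function.Periodic φθ (2 * π) := by
    intro θ
    simp only [hφθ]
    refine tsum_congr fun x => ?_
    rw [phase_insertNth, phase_insertNth, show (θ + 2 * π) * (x i : ℝ) + phase 2 k (fun j => x (i.succAbove j)) =
      θ * (x i : ℝ) + phase 2 k (fun j => x (i.succAbove j)) + (x i : ℤ) * (2 * π) by ring,
      Real.cos_add_int_mul_two_pi]
  have hgper : Function.Periodic g (2 * π) := fun θ => by simp only [hg, hφper θ]
  have hinv : Function.Involutive fun x : Site 3 => Function.update x i (-x i) := by
    intro x; ext j
    by_cases hj : j = i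
    · subst hj; simp
    · simp [Function.update_of_ne hj]
  set R : Site 3 ≃ Site 3 := hinv.toPerm _ with hR
  have hφeven : ∀ θ, φθ (-θ) = φθ θ := by
    intro θ
    simp only [hφθ]
    rw [← R.tsum_eq (fun x : Site 3 => q x * Real.cos (phase 3 (Fin.insertNth i θ k : Fin 3 → ℝ) x))]
    refine tsum_congr fun x => ?_
    have hRx : R x = Function.update x i (-x i) := rfl
    rw [hRx, hqrefl, phase_insertNth, phase_insertNth]
    congr 2
    simp only [Function.update_self, Int.cast_neg]
    have : (fun j => Function.update x i (-x i) (i.succAbove j)) = fun j => x (i.succAbove j) := by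
      funext j; rw [Function.update_of_ne (Fin.succAbove_ne i j)]
    rw [this]; ring
  have hgeven : ∀ θ, g (-θ) = g θ := fun θ => by simp only [hg, hφeven θ]
  have hmom' : ∀ n : ℕ, ∫ θ in (-π)..π, g θ * Real.cos (n * θ) = ∫ t, t ^ n ∂μ := by
    intro n
    rw [← hmom n]
    refine intervalIntegral.integral_congr fun θ _ => ?_
    simp only [hg]; rw [div_eq_mul_inv, mul_comm]
  refine ⟨hlt, hgcont, μ, hμfin, hμ0, ?_, fun θ hθ => ?_⟩
  · have h0 := hmom 0
    simp only [Nat.cast_zero, zero_mul, Real.cos_zero, pow_zero, one_div] at h0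
    rw [integral_const, smul_eq_mul, mul_one] at h0
    exact h0.symm
  · have h := two_pi_mul_eq_integral_poisson hgcont hgper hgeven hμ0 hmom' hθ
    simpa only [hg, hφθ] using h

/-- **Registered auxiliary stub `stub_slabModeExpDecay_auxAxisLineHol3`** (sub-goal of the brick
`stub_slabModeExpDecay_auxAxisLineHol` of `stub_slabModeExpDecay`): the Poisson representation of the Green
symbol function on an axis line at a transverse momentum off `(2πℤ)²`
(`slab_two_pi_mul_inv_eq_integral_poisson`). [folklore] -/
theorem stub_slabModeExpDecay_auxAxisLineHol3 : ∀ (q : Site 3 → ℝ) (P : ℕ → Site 3 → ℝ) (G : Site 3 → ℝ)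
    (i : Fin 3) (k : Fin 2 → ℝ),
    (∀ y, 0 ≤ q y) → Summable q → ∑' y, q y ≤ 1 → (∀ y, q (-y) = q y) →
    (∀ z, P 0 z = if z = 0 then 1 else 0) → (∀ j z, P (j + 1) z = ∑' y, q y * P j (z - y)) →
    (∀ z, HasSum (fun j => P j z) (G z)) → (∀ m : Fin 3, 0 < G (Pi.single m 1)) →
    (∀ y : Site 3, q (Function.update y i (-y i)) = q y) →
    (∀ (s : Finset (Fin 2 → ℤ)) (v : (Fin 2 → ℤ) → ℝ), ∃ μ : MeasureTheory.Measure ℝ,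
      MeasureTheory.IsFiniteMeasure μ ∧ μ (Set.Icc (0 : ℝ) 1)ᶜ = 0 ∧ ∀ n : ℕ,
        ∑ x ∈ s, ∑ y ∈ s, v x * v y * G (Fin.insertNth i (n : ℤ) (x - y) : Site 3) = ∫ t, t ^ n ∂μ) →
    (∃ j, ∀ z : ℤ, k j ≠ z * (2 * Real.pi)) →
    (∀ θ : ℝ, ∑' x : Site 3, q x * Real.cos (∑ j, (Fin.insertNth i θ k : Fin 3 → ℝ) j * (x j : ℝ)) < 1) ∧
    (Continuous fun θ : ℝ =>
      (1 - ∑' x : Site 3, q x * Real.cos (∑ j, (Fin.insertNth i θ k : Fin 3 → ℝ) j * (x j : ℝ)))⁻¹) ∧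
    ∃ μ : MeasureTheory.Measure ℝ, MeasureTheory.IsFiniteMeasure μ ∧ μ (Set.Icc (0 : ℝ) 1)ᶜ = 0 ∧
      μ.real Set.univ = ∫ θ in (-Real.pi)..Real.pi,
        (1 - ∑' x : Site 3, q x * Real.cos (∑ j, (Fin.insertNth i θ k : Fin 3 → ℝ) j * (x j : ℝ)))⁻¹ ∧
      ∀ θ : ℝ, Real.cos θ ≠ 1 →
        2 * Real.pi * (1 - ∑' x : Site 3, q x * Real.cos (∑ j, (Fin.insertNth i θ k : Fin 3 → ℝ) j * (x j : ℝ)))⁻¹ =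
          ∫ t, (1 - t ^ 2) / (1 - 2 * t * Real.cos θ + t ^ 2) ∂μ :=
  fun _ _ _ i _ hq0 hqs hq1 hqev hP0 hPs hGreen hGpos hqrefl hHS hk => by
    have h := slab_two_pi_mul_inv_eq_integral_poisson hq0 hqs hq1 hqev hP0 hPs hGreen hGpos i hqrefl hHS hk
    simpa only [phase] using h

end Slab

end Summit.CriticalPhenomena.Ising3DConformalLimit.Cruxes.DirectCorrelationStableTail.SelfEnergyPickInversion

end
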